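import Summits.ResolutionOfSingularities.ResolutionOfSingularities.Theorems.HilbertSamuelEliminationSigmaMaxModificationsStubCentreSeqPackage
import Summits.ResolutionOfSingularities.ResolutionOfSingularities.Theorems.SigmaMaxModifications.Negative.Levels
import Literature.AlgebraicGeometry.Resolution.HilbertSamuelStrata
import Literature.AlgebraicGeometry.Resolution.HilbertSamuelRegular
import Literature.AlgebraicGeometry.Resolution.HilbertSamuelIsolatedSingularities
import Literature.RingTheory.HilbertSamuel.HilbertFunctions
import Literature.RingTheory.HilbertSamuel.HilbertSamuelFunction
import Mathlib.AlgebraicGeometry.Morphisms.Proper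
import Mathlib.AlgebraicGeometry.Noetherian
import HarnessLib

/-!
# `SigmaMaxModifications` (crux stmt-ResolutionOfSingularities-18506, line `Sketch`):
# stub `nuEliminationsExist_succ` — level raising `N ↦ N + 1` for `ν`-eliminations

Stub `nuEliminationsExist_succ` of the lead skeleton `Sketch` for the crux
`Summit.ResolutionOfSingularities.ResolutionOfSingularities.Theses.HilbertSamuelElimination.SigmaMaxModifications`.

The open core of the line asks, for `X/k` reduced, separated, locally of finite type and
quasi-compact over a field `k` of characteristic `p`, a level `N ≥ dim X` and a maximal value
`ν ≠ Φ^{(N)}` of `Σ_X = {H^N_X(x)}` (Cossart–Jannsen–Saito, LNM 2270, Def. 2.28, Def. 2.35), for a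
blow-up sequence `s : CentreSeq X` with centres over the stratum `X(ν)`, `H^N` non-increasing
along `s.comp`, and `ν ∉ Σ_{s.top}` (the data of a `ν`-elimination, CJS Def. 6.14 with
Thm. 3.10 (1)). THIS FILE PROVES that the level-`N` statement (for all schemes of the class of
dimension `≤ N`) implies the level-`(N + 1)` statement for the same schemes: the binding level of
the core is `N = dim X`.

Mechanism (CJS Rem. 2.29 (b)), with the level-transfer lemmas of
`Theorems/SigmaMaxModifications/Negative/Levels.lean`. On a locally Noetherian scheme of dimension
`≤ N` one has `ψ_X(x) ≤ dim 𝒪_{X,x} ≤ N` at every point (`Negative.hsPsi_le_of_dim_le`), so no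
truncation occurs in `φ^N_X(x) = N - ψ_X(x)` and `H^{N+1}_X(x) = (H^N_X(x))^{(1)}` POINTWISE
(`Negative.hsFun_succ`). The partial-sum operator `ν ↦ ν^{(1)}` (`psum`) is monotone and
injective (`psum_mono`, `psum_injective`; it is NOT an order embedding, but that is never
needed): `X(ν^{(1)})` at level `N + 1` is `X(ν)` at level `N` (`Negative.hsStratum_succ_psum`), a
value `ν^{(1)}` maximal at level `N + 1` has `ν` maximal at level `N`
(`Negative.maximal_of_maximal_psum_succ`: `ν ≤ μ ⟹ ν^{(1)} ≤ μ^{(1)} ≤ ν^{(1)}` by maximality, so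
`μ = ν` by injectivity), `ν^{(1)} ≠ Φ^{(N+1)} = (Φ^{(N)})^{(1)}` gives `ν ≠ Φ^{(N)}`
(`iterPSum_succ`), monotonicity of `H^N` along `s.comp` gives monotonicity of `H^{N+1}`
(`Negative.hsFun_succ_le_of_le`; `dim s.top ≤ N` by `topologicalKrullDim_top_le`, `s.top` being
locally Noetherian as `s.comp` is proper), and `ν ∉ Σ_{s.top}(N)` gives
`ν^{(1)} ∉ Σ_{s.top}(N+1)` (`Negative.psum_not_mem_hsValues_succ`).

## Sources

* V. Cossart, U. Jannsen, S. Saito, *Desingularization: Invariants and Strategy — Application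
  to Dimension 2*, LNM 2270 (2020), Def. 2.28, Rem. 2.29 (b), Def. 2.35, Def. 6.14.
  [CossartJannsenSaito2020]
-/

set_option linter.dupNamespace false -- mandated namespace of this single-conjunct summit

noncomputable section

open CategoryTheory AlgebraicGeometry TopologicalSpace
open Literature.AlgebraicGeometry.Resolution Literature.RingTheory.HilbertSamuel

namespace Summit.ResolutionOfSingularities.ResolutionOfSingularities.Theorems.SigmaMaxModifications.Sketch

/-- **LEVEL RAISING for `ν`-eliminations (`N ↦ N + 1`).** If every reduced, separated, locally of
finite type and quasi-compact `X/k` (`char k = p` prime) of dimension `≤ N` admits, for every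
maximal value `ν ≠ Φ^{(N)}` of `Σ_X(N)`, a blow-up sequence with centres over `X(ν)` along
which `H^N` does not increase and after which `ν` is no longer a value (the data of a
`ν`-elimination, CJS Def. 6.14 with Thm. 3.10 (1)), then the same schemes admit the same data
at level `N + 1`: for `dim X ≤ N` one has `H^{N+1}_X = (H^N_X)^{(1)}` pointwise (Def. 2.28:
`φ^{N+1} = φ^N + 1` as `ψ_X ≤ dim X ≤ N`), `ν ↦ ν^{(1)}` is monotone and injective
(Rem. 2.29 (b)), so a maximal `ν' ≠ Φ^{(N+1)}` of `Σ_X(N+1)` is `ν^{(1)}` for a maximal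
`ν ≠ Φ^{(N)}` of `Σ_X(N)` with the same stratum, and the level-`N` sequence for `ν` works:
`H^{N+1}` is non-increasing along it (`dim s.top ≤ N`) and `ν^{(1)} ∉ Σ_{s.top}(N+1)`. Hence the
binding level of the open core is `N = dim X`. [cite: CossartJannsenSaito2020, Def. 2.28, Def. 6.14] -/
theorem nuEliminationsExist_succ :
    ∀ N : ℕ, (∀ p : ℕ, p.Prime → ∀ (k : Type) [Field k] [CharP k p] (X : Scheme.{0})
      (f : X ⟶ Spec (.of k)), IsSeparated f → LocallyOfFiniteType f → QuasiCompact f →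
      IsReduced X → topologicalKrullDim X ≤ (N : WithBot ℕ∞) →
      ∀ ν : ℕ → ℕ, Maximal (· ∈ Scheme.hsValues X N) ν → ν ≠ iterPSum N Phi →
        ∃ s : CentreSeq X, s.CentresOver (Scheme.hsStratum X N ν) ∧
          (∀ x' : s.top, Scheme.hsFun s.top N x' ≤ Scheme.hsFun X N (s.comp.base x')) ∧
          ν ∉ Scheme.hsValues s.top N) →
    ∀ p : ℕ, p.Prime → ∀ (k : Type) [Field k] [CharP k p] (X : Scheme.{0})
      (f : X ⟶ Spec (.of k)), IsSeparated f → LocallyOfFiniteType f → QuasiCompact f →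
      IsReduced X → topologicalKrullDim X ≤ (N : WithBot ℕ∞) →
      ∀ ν : ℕ → ℕ, Maximal (· ∈ Scheme.hsValues X (N + 1)) ν → ν ≠ iterPSum (N + 1) Phi →
        ∃ s : CentreSeq X, s.CentresOver (Scheme.hsStratum X (N + 1) ν) ∧
          (∀ x' : s.top,
            Scheme.hsFun s.top (N + 1) x' ≤ Scheme.hsFun X (N + 1) (s.comp.base x')) ∧
          ν ∉ Scheme.hsValues s.top (N + 1) := by
  intro N H p hp k _ _ X f hsep hft hqc hred hdim ν' hν' hν'Φ
  haveI := hft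
  haveI : IsLocallyNoetherian X := LocallyOfFiniteType.isLocallyNoetherian f
  -- `ψ_X ≤ N` everywhere, so `H^{N+1}_X = (H^N_X)^{(1)}` pointwise
  have hψ : ∀ y : X, Scheme.hsPsi X y ≤ N := Negative.hsPsi_le_of_dim_le hdim
  -- `ν' = H^{N+1}_X(x) = (H^N_X(x))^{(1)}` for a point `x` of the (non-empty) stratum `X(ν')`
  obtain ⟨x, rfl⟩ := hν'.1
  rw [Negative.hsFun_succ x (hψ x)] at hν' hν'Φ ⊢
  -- the level-`N` value `ν = H^N_X(x)` is maximal and `≠ Φ^{(N)}`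
  have hν : Maximal (· ∈ Scheme.hsValues X N) (Scheme.hsFun X N x) :=
    Negative.maximal_of_maximal_psum_succ hdim ⟨x, rfl⟩ hν'
  have hνΦ : Scheme.hsFun X N x ≠ iterPSum N Phi := fun h => hν'Φ (by rw [h, iterPSum_succ])
  -- the level-`N` elimination of `ν`, read at level `N + 1`
  obtain ⟨s, hover, hmono, hkill⟩ := H p hp k X f hsep hft hqc hred hdim _ hν hνΦ
  haveI : IsProper s.comp := s.isProper_comp
  haveI : IsLocallyNoetherian s.top := LocallyOfFiniteType.isLocallyNoetherian s.comp
  have hdim' : topologicalKrullDim s.top ≤ (N : WithBot ℕ∞) := topologicalKrullDim_top_le s hdim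
  have hψ' : ∀ x' : s.top, Scheme.hsPsi s.top x' ≤ N := Negative.hsPsi_le_of_dim_le hdim'
  refine ⟨s, ?_, fun x' => Negative.hsFun_succ_le_of_le (hψ _) (hψ' x') (hmono x'),
    Negative.psum_not_mem_hsValues_succ hdim' hkill⟩
  rwa [Negative.hsStratum_succ_psum hdim]

end Summit.ResolutionOfSingularities.ResolutionOfSingularities.Theorems.SigmaMaxModifications.Sketch

end
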